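import Summits.CriticalPhenomena.PercolationContinuityZ3.Theorems.Transplant.PlanarSkeletonFrmFromDefs
import Summits.CriticalPhenomena.PercolationContinuityZ3.Theorems.Transplant.SkelFrmFromBParamsFaceFloorsY2WA
import Summits.CriticalPhenomena.PercolationContinuityZ3.Theorems.Transplant.SkelFrmBParamsFaceFloorsY2WA
import Summits.CriticalPhenomena.PercolationContinuityZ3.Theorems.Transplant.SkelFrmFromBParamsFaceOriginsXA
import Summits.CriticalPhenomena.PercolationContinuityZ3.Theorems.Transplant.SkelFrmBParamsFaceOriginsXA
import Summits.CriticalPhenomena.PercolationContinuityZ3.Theorems.Transplant.SkelPhiFaceNumsCross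
import Summits.CriticalPhenomena.PercolationContinuityZ3.Theorems.Transplant.SkelFrmFromBParamsFaceRunA
import Summits.CriticalPhenomena.PercolationContinuityZ3.Theorems.Transplant.SkelFrmBParamsFaceRunA
import Summits.CriticalPhenomena.PercolationContinuityZ3.Theorems.Transplant.SkelFrmFromBParamsFaceCountsShiftA
import Summits.CriticalPhenomena.PercolationContinuityZ3.Theorems.Transplant.SkelFrmBParamsFaceCountsShiftA
import HarnessLib
import Summits.CriticalPhenomena.PercolationContinuityZ3.Theorems.Transplant.SkelFrmBParamsFaceFloorsYxA
/-!
# U-WAVE PORT (RULING D-U, lead g21 2026-08-26; WAVE-U-MANIFEST v3.1 row «SkelFrmBParamsFaceFloorsYxA» ↦ «SkelFrmFromBParamsFaceFloorsYxA») of the tree module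
# `Transplant/SkelFrmBParamsFaceFloorsYxA` onto the carrier `PlanarSkeletonFrmFrom` (frames only, cylinders connected from width `ℓ₀` on)

ORIGINAL TITLE: N2 (frames-only node, OPEN) — (F) column, (R-49)(c2b) VALUE LAYER part A: **THE COUNTS AND THE JUNCTION OF THE X4-SHAPED y′-FACE ROUTE**

builds on p205010 (kernel theorem, internal audit signed; external expert review pending) — nothing in this file uses p205010; NOTHING is claimed about the
OPEN node U `SamePDropOfSkeletonFrmFrom₁` (nor U_s / the end state).  Lane `prim-bschramm`, seat `prim-bschramm-stmt` gen 26 (port pen, RULING M-11 family P-stmt; tool = p3-g26's port_u.py of record, registry-driven inputs); helper file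
(`--supports stmt-CriticalPhenomena-4575 --as helper`).  PORT RULES r1–r4 of RULING D-U: declaration order and proof texts are those of the original,
byte-identical except (i) the carrier token `PlanarSkeletonFrm ↦ PlanarSkeletonFrmFrom` (binders, `namespace`/`end` lines, qualified names of twinned
declarations), (ii) carrier-FREE declarations of the original (φ-level `Skelφ…` blocks and namespace-only arithmetic residents) are NOT re-declared —
this file imports the original and `export`s the twin-free residents (POLICY T / treatment (m1)); residents whose statement mentions a twinned
constant are copied, (iii) every carrier-binding declaration keeps its explicit binder `(Φ : PlanarSkeletonFrmFrom G)` in its own signature (r2).  Docstrings and citations are the original's.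
-/

noncomputable section

open scoped Classical

namespace Summit.CriticalPhenomena.PercolationContinuityZ3.Theorems.Transplant

namespace PlanarSkeletonFrmFrom

namespace NegB

open Literature.Probability.Percolation Literature.Probability.LatticeModels SimpleGraph
open Literature.Probability.Percolation.KozmaNitzan.Cells (oth sgOf sgOf_sign)
open SkelConc (Consts)
open Skelφ (shearUnit shearUnit_pos crossOffY crossOffX xBoxLoA)
open Skelφ.StepI (DataN)
open TwoAxis.Para (modulus)
open Neg

namespace KS

export PlanarSkeletonFrm.NegB.KS (NX0)

/-- **The prefix count** `N_x := max NX0 (N3WY at the prefix's start reading yTX0 yL σ)`. [this work] -/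
def NxW (κ : Consts) {V : Type} [DecidableEq V] [Countable V] {G : SimpleGraph V} [G.LocallyFinite] (Φ : PlanarSkeletonFrmFrom G) (t : V) (p : unitInterval) (D : Skelφ.StepI.DataNS V) (g f : ℕ)
    (P : PCells2T) (yL x : Site 2) (du : MDir) (z : Site 2) (bw : ℕ) : ℕ :=
  max NX0 (N3WY κ Φ t p D g f P (yTX0 κ Φ t p D g f yL (sgOf du)) x du z bw)

/-- **The junction** `yT := yL + crossOffX n_L h_L v_L σ σ N_x` (end of the prefix plus one y′-step). [this work] -/
def yTYx (κ : Consts) {V : Type} [DecidableEq V] [Countable V] {G : SimpleGraph V} [G.LocallyFinite] (Φ : PlanarSkeletonFrmFrom G) (t : V) (p : unitInterval) (D : Skelφ.StepI.DataNS V) (g f : ℕ)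
    (P : PCells2T) (yL x : Site 2) (du : MDir) (z : Site 2) (bw : ℕ) : Site 2 :=
  yL + crossOffX (nL κ Φ t p D g f) (hL κ Φ t p D g f) (vL κ Φ t p D g f) (sgOf du) (sgOf du) (NxW κ Φ t p D g f P yL x du z bw)

variable (κ : Consts) {V : Type} [DecidableEq V] [Countable V] {G : SimpleGraph V} [G.LocallyFinite] (Φ : PlanarSkeletonFrmFrom G) (t : V) (p : unitInterval) (D : Skelφ.StepI.DataNS V)

/-- `NX0 ≤ N_x`. [folklore] -/
theorem NxW_ge (κ : Consts) {V : Type} [DecidableEq V] [Countable V] {G : SimpleGraph V} [G.LocallyFinite] (Φ : PlanarSkeletonFrmFrom G) (t : V) (p : unitInterval) (D : Skelφ.StepI.DataNS V) (g f : ℕ) (P : PCells2T) (yL x : Site 2) (du : MDir) (z : Site 2) (bw : ℕ) : NX0 ≤ NxW κ Φ t p D g f P yL x du z bw := le_max_left _ _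

/-- **The prefix count is in range**: `N_x + 1 ≤ 240·Kq + 10`, from `N3WY_range` at `yTX0 yL σ`. [folklore] -/
theorem NxW_range (κ : Consts) {V : Type} [DecidableEq V] [Countable V] {G : SimpleGraph V} [G.LocallyFinite] (Φ : PlanarSkeletonFrmFrom G) (t : V) (p : unitInterval) (D : Skelφ.StepI.DataNS V) (g f : ℕ) (P : PCells2T) (hP : P.toPCells2 = fcellsA κ Φ t p D g f) (yL x : Site 2) (du : MDir) (hd : du.1 = 1) (z : Site 2) {kE C₀ : ℤ}
    (hz : |z 0 - P.cenS x 0| ≤ kE) (hkE : kE ≤ 5 * (P.r 0 : ℤ))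
    (hC0 : |FcA κ Φ t p D g f (yTX0 κ Φ t p D g f yL (sgOf du))| ≤ C₀)
    (hC0' : C₀ ≤ 8 * u₀A κ Φ t p D g f) {bw : ℕ} (hbw : u₀A κ Φ t p D g f ≤ 2 * (bw : ℤ))
    (hF : FcA κ Φ t p D g f (yTX0 κ Φ t p D g f yL (sgOf du)) + u₀A κ Φ t p D g f ≤ T0Y P x du z + bw) :
    NxW κ Φ t p D g f P yL x du z bw + 1 ≤ 240 * Neg.Kq κ + 10 := by
  have h := N3WY_range κ Φ t p D g f P hP _ x du hd z hz hkE hC0 hC0' hbw hF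
  have hq := Neg.one_le_Kq κ
  unfold NxW NX0
  rcases le_total 6 (N3WY κ Φ t p D g f P (yTX0 κ Φ t p D g f yL (sgOf du)) x du z bw) with h5 | h5
  · rw [max_eq_right h5]; exact h
  · rw [max_eq_left h5]; omega

/-- **The junction's abscissa**: `σ·yT₀ = σ·yL₀ + (N_x + 1)·n_L + v_L` (`σ = sgOf du`, `σ² = 1`). [folklore] -/
theorem yTYx_zero (κ : Consts) {V : Type} [DecidableEq V] [Countable V] {G : SimpleGraph V} [G.LocallyFinite] (Φ : PlanarSkeletonFrmFrom G) (t : V) (p : unitInterval) (D : Skelφ.StepI.DataNS V) (g f : ℕ) (P : PCells2T) (yL x : Site 2) (du : MDir) (z : Site 2) (bw : ℕ) :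
    sgOf du * yTYx κ Φ t p D g f P yL x du z bw 0 =
      sgOf du * yL 0 + ((NxW κ Φ t p D g f P yL x du z bw : ℤ) + 1) * (nL κ Φ t p D g f : ℤ) + vL κ Φ t p D g f := by
  have hsq : sgOf du * sgOf du = 1 := by rcases sgOf_sign du with h | h <;> simp [h]
  unfold yTYx crossOffX
  rw [Pi.add_apply, Skelφ.pt_zero]
  have e : sgOf du * (yL 0 + (sgOf du * ((((NxW κ Φ t p D g f P yL x du z bw : ℕ) : ℤ) + 1) * (nL κ Φ t p D g f : ℤ)) + sgOf du * vL κ Φ t p D g f)) =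
      sgOf du * yL 0 + sgOf du * sgOf du * (((((NxW κ Φ t p D g f P yL x du z bw : ℕ) : ℤ) + 1) * (nL κ Φ t p D g f : ℤ)) + vL κ Φ t p D g f) := by ring
  rw [e, hsq, one_mul]; ring

/-- **THE ABSCISSA FLOOR OF THE SECOND RUN** at the x-face origin `yL := yLXFs σ`: `M_u + (N_x + 2)·n_L + nBF·0 + … ` — precisely
`M_u + (NX0 + 1)·n_L + NX0·R'0 + 1 ≤ σ·yT₀` whenever `|v_L| ≤ n_L` and the bridge count `c ≥ NX0` (`clearF`: `M_u + (c+1)·R'0 < nBF − R'0`,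
`σ·yLXFs₀ = n_L + nBF`). [folklore] -/
theorem absc_yTYx (κ : Consts) {V : Type} [DecidableEq V] [Countable V] {G : SimpleGraph V} [G.LocallyFinite] (Φ : PlanarSkeletonFrmFrom G) (t : V) (p : unitInterval) (D : Skelφ.StepI.DataNS V) (c mk g f : ℕ) (P : PCells2T) (x : Site 2) (du : MDir) (z : Site 2) (bw : ℕ) (hv : |vL κ Φ t p D g f| ≤ nL κ Φ t p D g f)
    (hc : NX0 ≤ c) :
    ((Mu D : ℕ) : ℤ) + ((NX0 : ℕ) + 1 : ℤ) * (nL κ Φ t p D g f : ℤ) + (NX0 : ℕ) * (KS0.R'0 κ Φ t p D mk : ℤ) + 1 ≤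
      sgOf du * yTYx κ Φ t p D g f P (yLXFs κ Φ t p D c mk g f (sgOf du)) x du z bw 0 := by
  rw [yTYx_zero, yLXFs_zero κ Φ t p D c mk g f (sgOf_sign du)]
  have h1 := clearF κ Φ t p D c mk
  have h2 := NxW_ge κ Φ t p D g f P (yLXFs κ Φ t p D c mk g f (sgOf du)) x du z bw
  have h3 : ((NX0 : ℕ) : ℤ) ≤ (NxW κ Φ t p D g f P (yLXFs κ Φ t p D c mk g f (sgOf du)) x du z bw : ℤ) := by exact_mod_cast h2
  have hc' : ((NX0 : ℕ) : ℤ) ≤ (c : ℤ) := by exact_mod_cast hc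
  have hR : (0 : ℤ) ≤ (KS0.R'0 κ Φ t p D mk : ℤ) := by positivity
  have hn : (0 : ℤ) ≤ (nL κ Φ t p D g f : ℤ) := by positivity
  have hv' := (abs_le.1 hv).1
  nlinarith

/-- **`hfit`**: `qBXFs + (N_x + 1)·R'0 ≤ n_L` (`qBXFs = R'0`, `N_x + 1 ≤ 240·Kq + 10`, `2000·Kq·(R'0+2) ≤ n_L`). [folklore] -/
theorem hfit_Yx (κ : Consts) {V : Type} [DecidableEq V] [Countable V] {G : SimpleGraph V} [G.LocallyFinite] (Φ : PlanarSkeletonFrmFrom G) (t : V) (p : unitInterval) (D : Skelφ.StepI.DataNS V) (mk g f : ℕ) (P : PCells2T) (hnA : 2000 * Neg.Kq κ * (KS0.R'0 κ Φ t p D mk + 2) ≤ nL κ Φ t p D g f) (yL x : Site 2) (du : MDir) (z : Site 2) (bw : ℕ)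
    (hN : NxW κ Φ t p D g f P yL x du z bw + 1 ≤ 240 * Neg.Kq κ + 10) :
    (qBXFs κ Φ t p D mk : ℤ) + ((NxW κ Φ t p D g f P yL x du z bw : ℤ) + 1) * (KS0.R'0 κ Φ t p D mk : ℤ) ≤ (nL κ Φ t p D g f : ℤ) := by
  unfold qBXFs
  have hq := Neg.one_le_Kq κ
  have hN' : ((NxW κ Φ t p D g f P yL x du z bw : ℤ) + 1) ≤ 240 * (Neg.Kq κ : ℤ) + 10 := by exact_mod_cast hN
  have hnA' : 2000 * (Neg.Kq κ : ℤ) * ((KS0.R'0 κ Φ t p D mk : ℤ) + 2) ≤ (nL κ Φ t p D g f : ℤ) := by exact_mod_cast hnA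
  have hR : (0 : ℤ) ≤ (KS0.R'0 κ Φ t p D mk : ℤ) := by positivity
  have hq' : (1 : ℤ) ≤ Neg.Kq κ := by exact_mod_cast hq
  nlinarith

/-- **`hq₃`**: `(n_Lℓ_L/U + 1) + (N_x + 1)·R'0 + 2 ≤ qB3XA R'0` — the x-face chain's second-run phase window `qB3XA R′ = Wrun + 1000·Kq·R′ + 2`
serves verbatim (by the cap `N_x + 1 ≤ 240·Kq + 10 ≤ 1000·Kq`). [folklore] -/
theorem hq₃_Yx (κ : Consts) {V : Type} [DecidableEq V] [Countable V] {G : SimpleGraph V} [G.LocallyFinite] (Φ : PlanarSkeletonFrmFrom G) (t : V) (p : unitInterval) (D : Skelφ.StepI.DataNS V) (mk g f : ℕ) (P : PCells2T) (yL x : Site 2) (du : MDir) (z : Site 2) (bw : ℕ) (hN : NxW κ Φ t p D g f P yL x du z bw + 1 ≤ 240 * Neg.Kq κ + 10) :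
    ((nL κ Φ t p D g f * ℓL κ Φ t p D g f / shearUnit (nL κ Φ t p D g f) (hL κ Φ t p D g f) + 1 : ℕ) : ℤ) +
        ((NxW κ Φ t p D g f P yL x du z bw : ℤ) + 1) * (KS0.R'0 κ Φ t p D mk : ℤ) + 2 ≤ (qB3XA κ Φ t p D g f (KS0.R'0 κ Φ t p D mk) : ℤ) := by
  unfold qB3XA Wrun
  have hq := Neg.one_le_Kq κ
  have hN' : ((NxW κ Φ t p D g f P yL x du z bw : ℤ) + 1) ≤ 1000 * (Neg.Kq κ : ℤ) := by
    have : ((NxW κ Φ t p D g f P yL x du z bw : ℤ) + 1) ≤ ((240 * Neg.Kq κ + 10 : ℕ) : ℤ) := by exact_mod_cast hN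
    push_cast at this
    have hq' : (1 : ℤ) ≤ Neg.Kq κ := by exact_mod_cast hq
    linarith
  have hR : (0 : ℤ) ≤ (KS0.R'0 κ Φ t p D mk : ℤ) := by positivity
  push_cast
  nlinarith

/-- **`hclr`: the prefix is α-clear of the seed** from the x-face origin (`M_u < σ·yL₀ − qBXFs − R'0 − n_L`, `hyL_XFs`): every region `k`
(`xBoxLoA k = k·n − q − k·R′ − R′ − n` is non-decreasing in `k` since `R′ ≤ n`). [folklore] -/
theorem hclr_Yx (κ : Consts) {V : Type} [DecidableEq V] [Countable V] {G : SimpleGraph V} [G.LocallyFinite] (Φ : PlanarSkeletonFrmFrom G) (t : V) (p : unitInterval) (D : Skelφ.StepI.DataNS V) (c mk g f : ℕ) (hRn : KS0.R'0 κ Φ t p D mk ≤ nL κ Φ t p D g f) (du : MDir) (N : ℕ) :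
    ∀ k ≤ N, ((Mu D : ℕ) : ℤ) < xBoxLoA (nL κ Φ t p D g f) (qBXFs κ Φ t p D mk) (KS0.R'0 κ Φ t p D mk) k + sgOf du * yLXFs κ Φ t p D c mk g f (sgOf du) 0 := by
  intro k _
  have h := hyL_XFs κ Φ t p D c mk g f (sgOf_sign du)
  unfold xBoxLoA
  have hk : (0 : ℤ) ≤ (k : ℤ) := by positivity
  have hRn' : (KS0.R'0 κ Φ t p D mk : ℤ) ≤ (nL κ Φ t p D g f : ℤ) := by exact_mod_cast hRn
  nlinarith

end KS

end NegB

end PlanarSkeletonFrmFrom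

end Summit.CriticalPhenomena.PercolationContinuityZ3.Theorems.Transplant

end
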